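import Summits.Ventures.LatticeQCDFlow.Scaling.SpiderPoincare
import Literature.Probability.MarkovChains.ProductChainSpectralGap
import Literature.Probability.MarkovChains.PathComparison

/-!
HONEST FRAMING: exact (Metropolis-corrected) sampling algorithms for lattice gauge theory; figures
of merit are autocorrelation/cost numbers at stated couplings and volumes; no continuum-physics
claim.

# ConveyorLadder — THE LABEL CONVEYOR ON `Fin (K+1) → J`: BUBBLING A LABEL TO THE HOT END BY ADJACENT
# TRANSPOSITIONS, ITS WEIGHT UNDER A PRODUCT LAW WITH TWO-SIDED PERSISTENCE (`≥ p·q^K`), THE KEPT FLOWS OF A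
# CHAIN WITH TRANSPOSITION AND HOT-RELABEL EDGES, AND THE EFRON–STEIN INEQUALITY (lean-2 GEN-18, ours)

Venture-side (OURS).  Cell `lqcd-flow` (pub-lqcd), unit `pub-lqcd-lean-2-g18`, 2026-08-25.  Groundwork for
`Scaling/ConveyorPoincare` (chapter C) — the replica-exchange counterpart of `Scaling/SpiderPoincare`: along the
"modes as blocks" decomposition of a replica-exchange sampler the projection chain lives on MODE ASSIGNMENTS
`z : Fin (K+1) → J` (the mode of the replica at each level), its law is the PRODUCT `ν⊗(z) = Π_k ν_k(z_k)` of the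
mode masses, and its edges are (i) ADJACENT TRANSPOSITIONS `z ↦ z ∘ swap(l, l+1)` (an accepted swap exchanges
the modes of two neighbouring replicas) and (ii) RELABELLING AT THE HOT END `z ↦ update z 0 v` (the hottest
replica changes mode on its own).  A label sitting at a cold level `k` is refreshed by riding the conveyor up
to level `0`, being relabelled there, and riding back; this file supplies the pieces of that comparison path.

## What is proved (finite-chain vocabulary of `Literature.Probability.MarkovChains`)

* §1 THE BUBBLED STATE `insertNth i (z k) (removeNth k z)` (the label of level `k` moved to level `i ≤ k`, the
  labels of levels `i … k−1` pushed one level colder): `insertNth_castSucc_comp_swap` — moving it one level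
  further is ONE adjacent transposition; `tensorFun_insertNth` — its weight.
* §2 WEIGHTS UNDER TWO-SIDED PERSISTENCE (`p·ν_k(j) ≤ ν_i(j)` for `i ≤ k`: heating keeps the fraction `p`;
  `q·ν_l(j) ≤ ν_{l+1}(j)`: cooling by ONE level keeps the fraction `q`): `prod_succAbove_ge` — pushing any set
  of labels one level colder costs at most `q^K`; **`tensorFun_bubble_ge`** — every bubbled state has weight
  `≥ p·q^K·ν⊗(z)`.
* §3 KEPT FLOWS: for any law `π ≥ 0` and matrix `Q ≥ 0` on `Fin (K+1) → J`,
  **`half_sum_transposition_le_dirichletForm`** — `½Σ_l Σ_z π(z)Q(z, z∘σ_l)(f z − f(z∘σ_l))² ≤ 𝓔_π(Q; f)`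
  (distinct transpositions of one state are distinct states) and **`half_sum_relabel_le_dirichletForm`** —
  `½Σ_z Σ_v π(z)Q(z, z⁰ᵛ)(f z − f z⁰ᵛ)² ≤ 𝓔_π(Q; f)`.
* §4 **`efronStein_tensorFun`** — `Var_{ν⊗}(f) ≤ Σ_k ½Σ_z Σ_v ν⊗(z)ν_k(v)(f z − f(update z k v))²` (the
  Literature's tensorisation `prodKernel_poincare`, Levin–Peres Cor. 12.13, applied to the product of the
  complete-mixing chains `limitMatrix ν_k`).

NOT CLAIMED: anything about a specific sampler; the Poincaré inequality itself (`Scaling/ConveyorPoincare`).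
Literature grade (cell rule): KNOWN MECHANISM (comparison paths for exclusion / interchange processes,
Diaconis–Saloff-Coste 1993; the persistence parameter of Woodard–Schmidler–Huber, Ann. Appl. Probab. 19 (2009)
617–640), NEW TYPING; nothing cited as a fact; no new bib keys.
-/

noncomputable section

open Finset Function
open Literature.Probability.MarkovChains

namespace Summit.Ventures.LatticeQCDFlow.Scaling

/-! ## §1 The bubbled state and one transposition -/

section Bubble

variable {J : Type*} {K : ℕ}

/-- **Moving the inserted label one level hotter is an adjacent transposition:**
`insertNth l a r = (insertNth (l+1) a r) ∘ swap(l, l+1)`. [ours] -/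
theorem insertNth_castSucc_comp_swap (l : Fin K) (a : J) (r : Fin K → J) :
    (Fin.insertNth l.castSucc a r : Fin (K + 1) → J)
      = (Fin.insertNth l.succ a r : Fin (K + 1) → J) ∘ Equiv.swap l.castSucc l.succ := by
  funext x
  simp only [Function.comp_apply]
  rcases Fin.eq_self_or_eq_succAbove l.castSucc x with rfl | ⟨j, rfl⟩
  · rw [Equiv.swap_apply_left, Fin.insertNth_apply_same, Fin.insertNth_apply_same]
  · rw [Fin.insertNth_apply_succAbove]
    by_cases hj : j = l
    · subst hj
      rw [Fin.succAbove_castSucc_self, Equiv.swap_apply_right, ← Fin.succAbove_succ_self,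
        Fin.insertNth_apply_succAbove]
    · rcases lt_or_gt_of_ne hj with h | h
      · rw [Fin.succAbove_castSucc_of_lt _ _ h]
        have h1 : j.castSucc ≠ l.castSucc := fun e => hj (Fin.castSucc_injective _ e)
        have h2 : j.castSucc ≠ l.succ := by
          intro e
          have : (j : ℕ) = l + 1 := by
            have := congrArg Fin.val e; simpa using this
          have hlt : (j : ℕ) < l := h
          omega
        rw [Equiv.swap_apply_of_ne_of_ne h1 h2, ← Fin.succAbove_succ_of_le _ _ h.le,
          Fin.insertNth_apply_succAbove]
      · rw [Fin.succAbove_castSucc_of_le _ _ h.le]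
        have h1 : j.succ ≠ l.castSucc := by
          intro e
          have : (j : ℕ) + 1 = l := by
            have := congrArg Fin.val e; simpa using this
          have hlt : (l : ℕ) < j := h
          omega
        have h2 : j.succ ≠ l.succ := fun e => (ne_of_gt h) (Fin.succ_injective _ e)
        rw [Equiv.swap_apply_of_ne_of_ne h1 h2, ← Fin.succAbove_succ_of_lt _ _ h,
          Fin.insertNth_apply_succAbove]

/-- **The weight of an inserted tuple:** `ν⊗(insertNth i a r) = ν_i(a)·Π_j ν_{i.succAbove j}(r_j)`. [ours] -/
theorem tensorFun_insertNth (ν : Fin (K + 1) → J → ℝ) (i : Fin (K + 1)) (a : J) (r : Fin K → J) :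
    tensorFun ν (Fin.insertNth i a r : Fin (K + 1) → J) = ν i a * ∏ j, ν (i.succAbove j) (r j) := by
  unfold tensorFun
  rw [Fin.prod_univ_succAbove _ i, Fin.insertNth_apply_same]
  congr 1
  exact prod_congr rfl fun j _ => by rw [Fin.insertNth_apply_succAbove]

/-- A state is its own label at level `k` inserted into the rest: `z = insertNth k (z k) (removeNth k z)`, as a
weight identity `ν⊗(z) = ν_k(z_k)·Π_j ν_{k.succAbove j}(z_{k.succAbove j})`. [ours] -/
theorem tensorFun_eq_insertNth (ν : Fin (K + 1) → J → ℝ) (k : Fin (K + 1)) (z : Fin (K + 1) → J) :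
    tensorFun ν z = ν k (z k) * ∏ j, ν (k.succAbove j) (Fin.removeNth k z j) := by
  conv_lhs => rw [← Fin.insertNth_self_removeNth k z]
  exact tensorFun_insertNth ν k (z k) (Fin.removeNth k z)

end Bubble

/-! ## §2 Weights under two-sided persistence -/

section Weights

variable {J : Type*} {K : ℕ} {ν : Fin (K + 1) → J → ℝ}

/-- **Pushing labels one level colder costs at most `q^K`:** if `q·ν_l(j) ≤ ν_{l+1}(j)` (`0 ≤ q ≤ 1`, `ν ≥ 0`),
then for `i ≤ k`, `q^K·Π_j ν_{k.succAbove j}(r_j) ≤ Π_j ν_{i.succAbove j}(r_j)` — the two products differ exactly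
at the indices `i ≤ j < k`, where the level is `j` on the left and `j+1` on the right. [ours] -/
theorem prod_succAbove_ge (hν0 : ∀ k j, 0 ≤ ν k j) {q : ℝ} (hq0 : 0 ≤ q) (hq1 : q ≤ 1)
    (hq : ∀ (l : Fin K) (j : J), q * ν l.castSucc j ≤ ν l.succ j) {i k : Fin (K + 1)} (hik : i ≤ k)
    (r : Fin K → J) :
    q ^ K * ∏ j, ν (k.succAbove j) (r j) ≤ ∏ j, ν (i.succAbove j) (r j) := by
  have hK : q ^ K = ∏ _j : Fin K, q := by rw [prod_const, card_univ, Fintype.card_fin]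
  rw [hK, ← prod_mul_distrib]
  refine prod_le_prod (fun j _ => mul_nonneg hq0 (hν0 _ _)) fun j _ => ?_
  by_cases h1 : j.castSucc < i
  · -- below `i`: both sides read level `j`
    rw [Fin.succAbove_of_castSucc_lt _ _ h1, Fin.succAbove_of_castSucc_lt _ _ (lt_of_lt_of_le h1 hik)]
    calc q * ν j.castSucc (r j) ≤ 1 * ν j.castSucc (r j) := mul_le_mul_of_nonneg_right hq1 (hν0 _ _)
      _ = ν j.castSucc (r j) := one_mul _
  · rw [not_lt] at h1
    rw [Fin.succAbove_of_le_castSucc _ _ h1]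
    by_cases h2 : j.castSucc < k
    · -- between `i` and `k`: level `j` on the left, `j+1` on the right
      rw [Fin.succAbove_of_castSucc_lt _ _ h2]
      exact hq j (r j)
    · rw [not_lt] at h2
      rw [Fin.succAbove_of_le_castSucc _ _ h2]
      calc q * ν j.succ (r j) ≤ 1 * ν j.succ (r j) := mul_le_mul_of_nonneg_right hq1 (hν0 _ _)
        _ = ν j.succ (r j) := one_mul _

/-- **Every bubbled state keeps the fraction `p·q^K` of the weight:** with persistence `p·ν_k(j) ≤ ν_i(j)`
(`i ≤ k`) and one-level cooling `q·ν_l(j) ≤ ν_{l+1}(j)`,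
`p·q^K·ν⊗(z) ≤ ν⊗(insertNth i (z k) (removeNth k z))` for every `i ≤ k`. [ours] -/
theorem tensorFun_bubble_ge (hν0 : ∀ k j, 0 ≤ ν k j) {p q : ℝ} (hq0 : 0 ≤ q) (hq1 : q ≤ 1)
    (hpers : ∀ (i k : Fin (K + 1)) (j : J), i ≤ k → p * ν k j ≤ ν i j)
    (hq : ∀ (l : Fin K) (j : J), q * ν l.castSucc j ≤ ν l.succ j) {i k : Fin (K + 1)} (hik : i ≤ k)
    (z : Fin (K + 1) → J) :
    p * q ^ K * tensorFun ν z
      ≤ tensorFun ν (Fin.insertNth i (z k) (Fin.removeNth k z) : Fin (K + 1) → J) := by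
  rw [tensorFun_eq_insertNth ν k z, tensorFun_insertNth]
  have hP0 : 0 ≤ ∏ j, ν (k.succAbove j) (Fin.removeNth k z j) := prod_nonneg fun j _ => hν0 _ _
  calc p * q ^ K * (ν k (z k) * ∏ j, ν (k.succAbove j) (Fin.removeNth k z j))
      = (p * ν k (z k)) * (q ^ K * ∏ j, ν (k.succAbove j) (Fin.removeNth k z j)) := by ring
    _ ≤ ν i (z k) * ∏ j, ν (i.succAbove j) (Fin.removeNth k z j) :=
        mul_le_mul (hpers i k (z k) hik) (prod_succAbove_ge hν0 hq0 hq1 hq hik _)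
          (mul_nonneg (pow_nonneg hq0 K) hP0) (hν0 _ _)

/-- The rest of a state pushed one level colder below `k` costs at most `q^K` against the rest read from
level `1` on: `q^K·Π_j ν_{k.succAbove j}(r_j) ≤ Π_j ν_{j+1}(r_j)`. [ours] -/
theorem prod_succAbove_ge_zero (hν0 : ∀ k j, 0 ≤ ν k j) {q : ℝ} (hq0 : 0 ≤ q) (hq1 : q ≤ 1)
    (hq : ∀ (l : Fin K) (j : J), q * ν l.castSucc j ≤ ν l.succ j) (k : Fin (K + 1)) (r : Fin K → J) :
    q ^ K * ∏ j, ν (k.succAbove j) (r j) ≤ ∏ j, ν j.succ (r j) := by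
  have h := prod_succAbove_ge hν0 hq0 hq1 hq (Fin.zero_le k) r
  simpa only [Fin.succAbove_zero] using h

end Weights

/-! ## §3 Kept flows: transposition edges and hot-relabel edges -/

section Kept

variable {J : Type*} [Fintype J] [DecidableEq J] {K : ℕ}

omit [Fintype J] [DecidableEq J] in
/-- A transposition that moves a state changes the two swapped labels: `z ∘ swap(l,l+1) ≠ z → z l ≠ z (l+1)`.
[ours] -/
theorem apply_ne_of_comp_swap_ne {z : Fin (K + 1) → J} {l : Fin K}
    (h : z ∘ Equiv.swap l.castSucc l.succ ≠ z) : z l.castSucc ≠ z l.succ := by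
  intro e
  apply h
  funext x
  simp only [Function.comp_apply]
  by_cases h1 : x = l.castSucc
  · subst h1; rw [Equiv.swap_apply_left, e]
  · by_cases h2 : x = l.succ
    · subst h2; rw [Equiv.swap_apply_right, e]
    · rw [Equiv.swap_apply_of_ne_of_ne h1 h2]

omit [Fintype J] in
/-- **Distinct moving transpositions give distinct states.** [ours] -/
theorem comp_swap_injOn (z : Fin (K + 1) → J) :
    Set.InjOn (fun l : Fin K => z ∘ Equiv.swap l.castSucc l.succ)
      ↑(univ.filter fun l : Fin K => z ∘ Equiv.swap l.castSucc l.succ ≠ z) := by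
  intro l hl l' hl' hll
  simp only [coe_filter, mem_univ, true_and, Set.mem_setOf_eq] at hl hl'
  have hz := apply_ne_of_comp_swap_ne hl
  have hz' := apply_ne_of_comp_swap_ne hl'
  simp only at hll
  by_contra hne
  -- evaluate the two composites at `l.castSucc` and at `l.succ`
  have e1 := congrFun hll l.castSucc
  have e2 := congrFun hll l.succ
  simp only [Function.comp_apply, Equiv.swap_apply_left, Equiv.swap_apply_right] at e1 e2
  by_cases ha : l.castSucc = l'.succ
  · -- then `l.succ` is fixed by the other swap
    have hb1 : l.succ ≠ l'.castSucc := by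
      intro e; have := congrArg Fin.val e; have := congrArg Fin.val ha; simp at *; omega
    have hb2 : l.succ ≠ l'.succ := fun e => hne (Fin.succ_injective _ e)
    rw [Equiv.swap_apply_of_ne_of_ne hb1 hb2] at e2
    exact hz e2
  · by_cases hb : l.castSucc = l'.castSucc
    · exact hne (Fin.castSucc_injective _ hb)
    · rw [Equiv.swap_apply_of_ne_of_ne hb ha] at e1
      exact hz e1.symm

/-- **The transposition edges are kept:** for `π ≥ 0`, `Q ≥ 0`,
`½Σ_l Σ_z π(z)Q(z, z∘σ_l)(f z − f(z∘σ_l))² ≤ 𝓔_π(Q; f)`. [ours] -/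
theorem half_sum_transposition_le_dirichletForm {π : (Fin (K + 1) → J) → ℝ} (hπ : ∀ z, 0 ≤ π z)
    {Q : Matrix (Fin (K + 1) → J) (Fin (K + 1) → J) ℝ} (hQ : ∀ z y, 0 ≤ Q z y) (f : (Fin (K + 1) → J) → ℝ) :
    (1 / 2) * ∑ l : Fin K, ∑ z, π z * Q z (z ∘ Equiv.swap l.castSucc l.succ)
        * (f z - f (z ∘ Equiv.swap l.castSucc l.succ)) ^ 2
      ≤ dirichletForm π Q f := by
  unfold dirichletForm
  rw [sum_comm]
  refine mul_le_mul_of_nonneg_left (sum_le_sum fun z _ => ?_) (by norm_num)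
  set F : (Fin (K + 1) → J) → ℝ := fun y => π z * Q z y * (f z - f y) ^ 2 with hF
  have hF0 : ∀ y, 0 ≤ F y := fun y => mul_nonneg (mul_nonneg (hπ z) (hQ z y)) (sq_nonneg _)
  set s := univ.filter fun l : Fin K => z ∘ Equiv.swap l.castSucc l.succ ≠ z with hs
  have h1 : ∑ l : Fin K, F (z ∘ Equiv.swap l.castSucc l.succ)
      = ∑ l ∈ s, F (z ∘ Equiv.swap l.castSucc l.succ) := by
    rw [hs, sum_filter]
    refine sum_congr rfl fun l _ => ?_
    split_ifs with h
    · rfl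
    · rw [not_not] at h
      rw [h, hF]
      simp
  have h2 : ∑ l ∈ s, F (z ∘ Equiv.swap l.castSucc l.succ)
      = ∑ y ∈ s.image (fun l : Fin K => z ∘ Equiv.swap l.castSucc l.succ), F y :=
    (sum_image (comp_swap_injOn z)).symm
  change ∑ l : Fin K, F (z ∘ Equiv.swap l.castSucc l.succ) ≤ ∑ y, F y
  rw [h1, h2]
  exact sum_le_sum_of_subset_of_nonneg (subset_univ _) fun y _ _ => hF0 y

/-- **The hot-relabel edges are kept:** for `π ≥ 0`, `Q ≥ 0`,
`½Σ_z Σ_v π(z)Q(z, update z 0 v)(f z − f(update z 0 v))² ≤ 𝓔_π(Q; f)`. [ours] -/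
theorem half_sum_relabel_le_dirichletForm {π : (Fin (K + 1) → J) → ℝ} (hπ : ∀ z, 0 ≤ π z)
    {Q : Matrix (Fin (K + 1) → J) (Fin (K + 1) → J) ℝ} (hQ : ∀ z y, 0 ≤ Q z y) (f : (Fin (K + 1) → J) → ℝ) :
    (1 / 2) * ∑ z, ∑ v, π z * Q z (update z 0 v) * (f z - f (update z 0 v)) ^ 2
      ≤ dirichletForm π Q f := by
  unfold dirichletForm
  refine mul_le_mul_of_nonneg_left (sum_le_sum fun z _ => ?_) (by norm_num)
  set F : (Fin (K + 1) → J) → ℝ := fun y => π z * Q z y * (f z - f y) ^ 2 with hF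
  have hF0 : ∀ y, 0 ≤ F y := fun y => mul_nonneg (mul_nonneg (hπ z) (hQ z y)) (sq_nonneg _)
  have hinj : Set.InjOn (fun v : J => update z 0 v) ↑(univ : Finset J) :=
    fun v _ v' _ h => update_injective z 0 h
  change ∑ v, F (update z 0 v) ≤ ∑ y, F y
  rw [← sum_image hinj]
  exact sum_le_sum_of_subset_of_nonneg (subset_univ _) fun y _ _ => hF0 y

end Kept

/-! ## §4 The Efron–Stein inequality for a product law -/

section EfronStein

variable {J : Type*} [Fintype J] [DecidableEq J] {K : ℕ} {ν : Fin (K + 1) → J → ℝ}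

/-- The Dirichlet form of the product of the complete-mixing chains `limitMatrix ν_k` (a uniformly chosen level
resamples its label from `ν_k`):
`𝓔 = (1/(K+1))·Σ_k ½Σ_z Σ_v ν⊗(z)ν_k(v)(f z − f(update z k v))²`. [ours] -/
theorem dirichletForm_prodKernel_limitMatrix (f : (Fin (K + 1) → J) → ℝ) :
    dirichletForm (tensorFun ν) (prodKernel (fun _ : Fin (K + 1) => (1 : ℝ) / (K + 1))
        (fun k => (limitMatrix (ν k) : J → J → ℝ))) f
      = (1 : ℝ) / (K + 1) * ∑ k : Fin (K + 1),
          (1 / 2) * ∑ z : Fin (K + 1) → J, ∑ v, tensorFun ν z * ν k v * (f z - f (update z k v)) ^ 2 := by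
  unfold dirichletForm
  have h1 : ∀ z : Fin (K + 1) → J,
      ∑ y, tensorFun ν z * prodKernel (fun _ : Fin (K + 1) => (1 : ℝ) / (K + 1))
          (fun k => (limitMatrix (ν k) : J → J → ℝ)) z y * (f z - f y) ^ 2
        = tensorFun ν z * ((1 : ℝ) / (K + 1) * ∑ k : Fin (K + 1), ∑ v, ν k v * (f z - f (update z k v)) ^ 2) := by
    intro z
    have h := sum_prodKernel_mul (fun k => (limitMatrix (ν k) : J → J → ℝ))
      (fun _ : Fin (K + 1) => (1 : ℝ) / (K + 1)) z (fun y => (f z - f y) ^ 2)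
    simp_rw [mul_assoc]
    rw [← mul_sum, h, ← mul_sum]
    rfl
  simp_rw [h1, mul_sum]
  rw [sum_comm]
  refine sum_congr rfl fun k _ => sum_congr rfl fun z _ => sum_congr rfl fun v _ => ?_
  ring

/-- **EFRON–STEIN:** for probability vectors `ν_k ≥ 0`,
`Var_{ν⊗}(f) ≤ Σ_k ½Σ_z Σ_v ν⊗(z)ν_k(v)(f z − f(update z k v))²` — the variance under a product law is at
most the sum of the expected one-coordinate variances (tensorisation, Levin–Peres Cor. 12.13, PROVED in the
Literature, applied to the complete-mixing chains, each of Poincaré constant `1`). [ours] -/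
theorem efronStein_tensorFun (hν0 : ∀ k j, 0 ≤ ν k j) (hν1 : ∀ k, ∑ j, ν k j = 1)
    (f : (Fin (K + 1) → J) → ℝ) :
    lawVariance (tensorFun ν) f
      ≤ ∑ k : Fin (K + 1),
          (1 / 2) * ∑ z : Fin (K + 1) → J, ∑ v, tensorFun ν z * ν k v * (f z - f (update z k v)) ^ 2 := by
  have hKpos : (0 : ℝ) < K + 1 := by positivity
  have h := prodKernel_poincare (K + 1) (X := fun _ : Fin (K + 1) => J) (π := ν)
    (P := fun k => (limitMatrix (ν k) : J → J → ℝ)) (w := fun _ => (1 : ℝ) / (K + 1))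
    (γ := fun _ => (1 : ℝ)) (c := (1 : ℝ) / (K + 1)) hν0 hν1
    (fun k u v => by simp only [limitMatrix, Matrix.of_apply]; exact hν0 k v)
    (fun _ => by positivity) (fun _ => by rw [mul_one])
    (fun k h => by rw [one_mul, dirichletForm_limitMatrix (hν1 k)]) f
  rw [dirichletForm_prodKernel_limitMatrix] at h
  have h' := mul_le_mul_of_nonneg_left h hKpos.le
  have e1 : (K + 1 : ℝ) * ((1 : ℝ) / (K + 1) * lawVariance (tensorFun ν) f) = lawVariance (tensorFun ν) f := by
    field_simp
  have e2 : ∀ S : ℝ, (K + 1 : ℝ) * ((1 : ℝ) / (K + 1) * S) = S := fun S => by field_simp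
  rwa [e1, e2] at h'

end EfronStein

end Summit.Ventures.LatticeQCDFlow.Scaling
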